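import Literature.NumberTheory.ComplexMultiplication.CMTypeRankEvaluationCriterion
import Literature.NumberTheory.ComplexMultiplication.CMTypeRankTypeConjugation
import HarnessLib

/-!
# Rank additivity for a pair of CM types when the subgroup generated by the two type stabilisers contains the
# conjugation of a slot ("the reflex fields meet in a totally real field")

Companion of `NumberTheory/ComplexMultiplication/CMTypeRankEvaluationCriterion` (the non-abelian Kubota criterion:
`U(Σ) = ⊕_i U(Φ_i)` — on Hodge groups `Hg(∏ A_i) = ∏ Hg(A_i)` — iff in every irreducible `ℚ`-representation `(π, V)`
of `G` the evaluation vectors `T_i(u_1(Φ_i))` of equivariant `T_i : ℚ^{E_i} → V` are linearly independent) and of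
`CMTypeRankTypeConjugation` §2 (stabiliser separation).  A two-slot consequence that needs NO knowledge of the
representations:

> **Theorem** (`forall_map_slotExt_le_of_smul_eq_rho_of_mem_closure`).  Let `Φ₀ ⊆ E_{i₀}`, `Φ₁ ⊆ E_{i₁}` be CM types
> for `ρ` and `S_k = {g | gΦ_k = Φ_k}` their stabilisers.  If the subgroup generated by `S₀ ∪ S₁` contains an element
> acting on `E_{i₀}` as `ρ` does, then `U(Σ) = U(Φ₀) ⊕ U(Φ₁)` (`rank(Φ₀, Φ₁) − 1 = (rank Φ₀ − 1) + (rank Φ₁ − 1)`).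

PROOF.  In the criterion, `v := T₀(u_{Φ₀}) = −T₁(u_{Φ₁})` is fixed by `π(S₀)` (as `u_{Φ₀}` is) and by `π(S₁)` (as
`u_{Φ₁}` is), hence by the generated subgroup; an element of it acting as `ρ` on `E_{i₀}` sends `u_{Φ₀}` to `−u_{Φ₀}`,
so `v = −v = 0`.  For CM fields (`G = Aut(ℂ)`, `S_k = Aut(ℂ/K_k*)` with `K_k*` the reflex field of `(K_k, Φ_k)`): the
hypothesis says that complex conjugation fixes `K₀* ∩ K₁*`, i.e. THE TWO REFLEX FIELDS MEET IN A TOTALLY REAL FIELD —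
weaker than "the Galois closures meet in a totally real field" (`PartialConjugationOfRealIntersection`), and covering
pairs with a common constituent (e.g. the two non-conjugate sextic CM subfields `K⁺(√−m)`, `K⁺(√−md)` of one Galois
CM field of degree `12`, whose spans share the two-dimensional constituent).  Also the `n`-slot form with one
distinguished slot (`forall_map_slotExt_le_pair_of_smul_eq_rho_of_mem_closure` is the two-slot packaging) and the rank
corollaries.  Theorems only: no definition, no named fact, no `sorry`.

## References

* [Gordon1999HodgeAVSurvey] B. B. Gordon, *A survey of the Hodge conjecture for abelian varieties*, §3 Theorem
  (proof), 7.5–7.7.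
* [Shimura1998] G. Shimura, *Abelian Varieties with Complex Multiplication and Modular Functions*, §8.3 (reflex field
  = fixed field of the stabiliser of the type).
* [Deligne1982HodgeCycles] P. Deligne, *Hodge cycles on abelian varieties*, LNM 900 (1982), I Ex. 3.7 (c).
-/

set_option autoImplicit false

universe u v

namespace Literature.NumberTheory.ComplexMultiplication

variable {G : Type u} [Group G] {I : Type v} {E : I → Type v} [∀ i, MulAction G (E i)]
  [Fintype I] [DecidableEq I] [∀ i, Fintype (E i)]

/-- `u_1(Φ) ∘ s⁻¹ = u_1(Φ)` for `s` in the stabiliser of the type `Φ`. [cite: Shimura1998, §8.3] -/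
theorem antiVec_one_comp_inv_smul_of_stabilizes {X : Type*} [MulAction G X] {Φ : Set X} {s : G}
    (hs : ∀ x : X, s • x ∈ Φ ↔ x ∈ Φ) : (fun x => antiVec Φ (1 : G) (s⁻¹ • x)) = antiVec Φ (1 : G) := by
  funext x
  have h := hs (s⁻¹ • x)
  rw [smul_inv_smul] at h
  simp only [antiVec]
  by_cases hx : x ∈ Φ
  · rw [translateInd_of_mem (by rw [one_smul]; exact h.1 hx), translateInd_of_mem (by rw [one_smul]; exact hx)]
  · rw [translateInd_of_not_mem (by rw [one_smul]; exact fun hc => hx (h.2 hc)),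
      translateInd_of_not_mem (by rw [one_smul]; exact hx)]

/-- `u_1(Φ) ∘ g⁻¹ = −u_1(Φ)` for `g` acting on the slot as the conjugation `ρ`. [cite: Shimura1998, §8.3] -/
theorem antiVec_one_comp_inv_smul_of_smul_eq_rho {X : Type*} [MulAction G X] {ρ : G} {Φ : Set X}
    (h : IsCMTypeWith ρ Φ) {g : G} (hg : ∀ x : X, g • x = ρ • x) :
    (fun x => antiVec Φ (1 : G) (g⁻¹ • x)) = -antiVec Φ (1 : G) := by
  funext x
  have hgx : g⁻¹ • x = ρ • x := by
    rw [inv_smul_eq_iff, hg, h.invol]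
  simp only [antiVec, Pi.neg_apply, hgx]
  by_cases hx : x ∈ Φ
  · rw [translateInd_of_not_mem (by rw [one_smul]; exact (h.mem_iff x).1 hx),
      translateInd_of_mem (by rw [one_smul]; exact hx)]
    norm_num
  · rw [translateInd_of_mem (by rw [one_smul]; by_contra hc; exact hx ((h.mem_iff x).2 hc)),
      translateInd_of_not_mem (by rw [one_smul]; exact hx)]
    norm_num

/-- **Rank additivity for a pair when `⟨Stab Φ₀, Stab Φ₁⟩` contains the conjugation of a slot.**  If some element of
the subgroup generated by the stabilisers of `Φ_{i₀}` and `Φ_{i₁}` acts on `E_{i₀}` as `ρ`, then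
`ext_i U(Φ_i) ≤ U(Σ)` for both slots of the two-slot family (`U(Σ) = U(Φ₀) ⊕ U(Φ₁)`, `Hg(A₀ × A₁) = Hg(A₀) × Hg(A₁)`):
in every representation the evaluation vector `T₀(u_{Φ₀}) = −T₁(u_{Φ₁})` is fixed by both stabilisers and negated by
that element. [cite: Gordon1999HodgeAVSurvey, §3 Theorem (proof)] [cite: Deligne1982HodgeCycles, I Ex. 3.7 (c)] -/
theorem forall_map_slotExt_le_of_smul_eq_rho_of_mem_closure {ρ : G} {Φ : ∀ i, Set (E i)}
    (h : ∀ i, IsCMTypeWith ρ (Φ i)) {i₀ i₁ : I} (hI : ∀ j, j = i₀ ∨ j = i₁) (h01 : i₀ ≠ i₁)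
    (hg : ∃ g ∈ Subgroup.closure
        ({s : G | ∀ x : E i₀, s • x ∈ Φ i₀ ↔ x ∈ Φ i₀} ∪ {s : G | ∀ y : E i₁, s • y ∈ Φ i₁ ↔ y ∈ Φ i₁}),
      ∀ x : E i₀, g • x = ρ • x) :
    ∀ i, (antiSpan G (Φ i)).map (slotExt i) ≤ antiSpan G (sigmaType Φ) := by
  refine forall_map_slotExt_le_of_forall_irreducible Φ fun V _ _ _ π _ T hT hsum => ?_
  obtain ⟨g, hgmem, hgρ⟩ := hg
  -- `v := T_{i₀}(u₀) = −T_{i₁}(u₁)`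
  have hsum2 : T i₀ (antiVec (Φ i₀) (1 : G)) + T i₁ (antiVec (Φ i₁) (1 : G)) = 0 := by
    rw [Fintype.sum_eq_add i₀ i₁ h01 (fun j hj => ?_)] at hsum
    · exact hsum
    · rcases hI j with rfl | rfl
      · exact absurd rfl hj.1
      · exact absurd rfl hj.2
  set v := T i₀ (antiVec (Φ i₀) (1 : G)) with hv
  -- `v` is fixed by the generated subgroup
  have hfix : ∀ s ∈ Subgroup.closure
      ({s : G | ∀ x : E i₀, s • x ∈ Φ i₀ ↔ x ∈ Φ i₀} ∪ {s : G | ∀ y : E i₁, s • y ∈ Φ i₁ ↔ y ∈ Φ i₁}),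
      π s v = v := by
    intro s hs
    induction hs using Subgroup.closure_induction with
    | mem s hs =>
      rcases hs with hs | hs
      · rw [hv, ← hT i₀ s, antiVec_one_comp_inv_smul_of_stabilizes hs]
      · have hv' : v = -T i₁ (antiVec (Φ i₁) (1 : G)) := eq_neg_of_add_eq_zero_left hsum2
        rw [hv', map_neg, ← hT i₁ s, antiVec_one_comp_inv_smul_of_stabilizes hs]
    | one => rw [map_one, Module.End.one_apply]
    | mul a b _ _ ha hb => rw [map_mul, Module.End.mul_apply, hb, ha]
    | inv a _ ha =>
      have := congrArg (π a⁻¹) ha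
      rw [← Module.End.mul_apply, ← map_mul, inv_mul_cancel, map_one, Module.End.one_apply] at this
      exact this.symm
  -- and negated by `g`
  have hneg : π g v = -v := by
    rw [hv, ← hT i₀ g, antiVec_one_comp_inv_smul_of_smul_eq_rho (h i₀) hgρ, map_neg]
  have hv0 : v = 0 := by
    have h2 : (2 : ℚ) • v = 0 := by rw [two_smul]; nth_rw 1 [← hfix g hgmem]; rw [hneg, neg_add_cancel]
    exact (smul_eq_zero.1 h2).resolve_left two_ne_zero
  have hv1 : T i₁ (antiVec (Φ i₁) (1 : G)) = 0 := by
    rw [hv0, zero_add] at hsum2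
    exact hsum2
  intro i
  rcases hI i with rfl | rfl
  · exact hv0
  · exact hv1

variable [Nonempty I] [∀ i, Nonempty (E i)]

/-- **Rank additivity for the pair**: `rank(Φ₀, Φ₁) + 2 = rank Φ₀ + rank Φ₁ + 1` when `⟨Stab Φ₀, Stab Φ₁⟩` contains the
conjugation of a slot. [cite: Gordon1999HodgeAVSurvey, §3 Theorem (1) and 7.7] -/
theorem typeRank_sigmaType_add_card_eq_of_smul_eq_rho_of_mem_closure {ρ : G} {Φ : ∀ i, Set (E i)}
    (h : ∀ i, IsCMTypeWith ρ (Φ i)) {i₀ i₁ : I} (hI : ∀ j, j = i₀ ∨ j = i₁) (h01 : i₀ ≠ i₁)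
    (hg : ∃ g ∈ Subgroup.closure
        ({s : G | ∀ x : E i₀, s • x ∈ Φ i₀ ↔ x ∈ Φ i₀} ∪ {s : G | ∀ y : E i₁, s • y ∈ Φ i₁ ↔ y ∈ Φ i₁}),
      ∀ x : E i₀, g • x = ρ • x) :
    typeRank G (sigmaType Φ) + Fintype.card I = (∑ i, typeRank G (Φ i)) + 1 :=
  typeRank_sigmaType_add_card_eq_of_forall_map_le h
    (forall_map_slotExt_le_of_smul_eq_rho_of_mem_closure h hI h01 hg)

/-- **The pair is nondegenerate iff both members are**, when `⟨Stab Φ₀, Stab Φ₁⟩` contains the conjugation of a slot.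
[cite: Gordon1999HodgeAVSurvey, §3 Theorem and 7.6.1] -/
theorem typeRank_sigmaType_eq_iff_forall_of_smul_eq_rho_of_mem_closure {ρ : G} {Φ : ∀ i, Set (E i)}
    (h : ∀ i, IsCMTypeWith ρ (Φ i)) {i₀ i₁ : I} (hI : ∀ j, j = i₀ ∨ j = i₁) (h01 : i₀ ≠ i₁)
    (hg : ∃ g ∈ Subgroup.closure
        ({s : G | ∀ x : E i₀, s • x ∈ Φ i₀ ↔ x ∈ Φ i₀} ∪ {s : G | ∀ y : E i₁, s • y ∈ Φ i₁ ↔ y ∈ Φ i₁}),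
      ∀ x : E i₀, g • x = ρ • x) :
    typeRank G (sigmaType Φ) = Fintype.card (Σ i, E i) / 2 + 1 ↔
      ∀ i, typeRank G (Φ i) = Fintype.card (E i) / 2 + 1 :=
  typeRank_sigmaType_eq_iff_forall_of_forall_map_le h
    (forall_map_slotExt_le_of_smul_eq_rho_of_mem_closure h hI h01 hg)

end Literature.NumberTheory.ComplexMultiplication
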